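import Literature.IUT.LogThetaLattice.LatticeGlueOfKitsToy
import Literature.IUT.LogThetaLattice.StripFrameWitness
import HarnessLib

/-!
# [IUTchIII] Thm 1.5 (v): functoriality of the `ℝ_{>0}`-orbit of realified Kummer isomorphisms — what it is, where it holds, what it gives

Mochizuki, *Inter-universal Teichmüller Theory III*, kurims manuscript (May 2020), §1, Thm 1.5 (v) pp.50–51 ("compatible …
with the `ℝ_{>0}`-orbits of the isomorphisms `(^{n,m}C^⊩_△, …) ⥲ (D^⊩(^{n,m}D^⊢_△), …)` of [IUTchII] Cor 4.6 (ii)"), §2,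
Cor 2.3 (iv) p.75 ("stabilized/equivariant/functorial with respect to arbitrary automorphisms"); *II* (Dec 2020) Cor 4.6 (ii)
p.133 ("functorial algorithm … `ℝ_{>0}`-orbits of isomorphisms"). [claim: Mochizuki2012, status: disputed] (D-0012 claim key).
PROOF-ONLY file (no definition, nothing asserted about [IUTchIII]); abc-iut cell GAP-LEDGER row **G-w4d026-1** (owner
abc-iut-L6-t3): the interface `BiCoricData` (`BiCores.lean`) carries the orbit `realifiedKummer` but no naturality LAW for it.

THE LAW (the row's literal shape, that of the existing law `BiCoricData.monoFxm_map`). For `B : BiCoricData S`: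
for every isomorphism of Hodge theaters `ξ : X ≅ Y` and every `e ∈ B.realifiedKummer X`,
`(B.realifiedHT.mapIso ξ)⁻¹ ≪≫ e ≪≫ B.realified.mapIso (B.dvDelta.mapIso (S.htToD.mapIso ξ)) ∈ B.realifiedKummer Y`.
It is written out as an explicit hypothesis / conclusion below (no `Prop`-valued definition before the owner's successor
structure). Contents:

* §1 the law HOLDS whenever every orbit is the full poly-isomorphism (`realifiedKummer_map_of_full`) — the reading of
  record of abc-iut-w4-d009 / w4-d005 (in `RlfData` the Hom-sets are `ℝ_{>0}`-torsors, so the `ℝ_{>0}`-orbit IS the full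
  poly-isomorphism: `BiCoresRealifiedDFunctorWitness.rlfBiCoric_realifiedKummer_map_eq_orbit`); in particular at this
  seat's witnesses `Witness.twoBiCoric`, `Witness.twoBiCoricRigid` (`StripFrameWitness.lean`);
* §2 under the law the orbit is transported EXACTLY (`mem_realifiedKummer_iff_conj`), and — the consequence the row names —
  the Thm 1.5 (v) transported poly-isomorphism `realifiedTransport X Y` of Frobenius-like data
  `(^XC^⊩_△, …) ⥲ (^YC^⊩_△, …)` is FUNCTORIAL in arbitrary isomorphisms of Hodge theaters at both ends
  (`realifiedTransport_conj`), in particular stabilized by `Aut(^XHT) × Aut(^YHT)` (`realifiedTransport_stabilized`) —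
  the `ℝ_{>0}`-orbit half of [IUTchIII] Cor 2.3 (iv) recorded as a SLOT in `EtalePictureThetaProofs.lean`;
* §3 at the REAL frame: for `BiCoricData.ofKits … Bk` (`BiCoresOfKits`) the law is EQUIVALENT to the same law on the
  kit-level orbit `BiCoricKit.realifiedKummer` (`BiCoricData.ofKits_realifiedKummer_map_iff`) — an input BY NAME for the
  genuine kit (owner abc-iut-L6-t2, [IUTchII] Cor 4.6 (ii)); it HOLDS at the toy kit stack (`KitsToy.biCoricKit`, whose orbit
  is full: `KitsToy.latticeGlue_realifiedKummer_map`).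

Honest framing: a consistency / reduction record for OUR typed interfaces; no side taken on [IUTchIII] Cor 3.12;
typed ≠ proved.
-/

namespace Literature.IUT.LogThetaLattice

open CategoryTheory
open Literature.IUT.HodgeTheaters Literature.IUT.HodgeTheaters.PMBaseKit
open AsSmallTransport

universe u

/-! ### 1. The law, and the full-orbit case -/

namespace BiCoricData

variable {S : StripFrame.{u}} (B : BiCoricData S)

/-- **IUTchIII:Thm1.5(v)** (kurims p.51) If every `ℝ_{>0}`-orbit datum `realifiedKummer X` is the FULL poly-isomorphism (the reading in which
the Hom-sets of the realified data are `ℝ_{>0}`-torsors), the functoriality law of GAP row G-w4d026-1 holds: transport along an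
isomorphism of Hodge theaters carries the orbit at `X` into the orbit at `Y`. [claim: Mochizuki2012, status: disputed] -/
theorem realifiedKummer_map_of_full (hfull : ∀ X : S.HT, B.realifiedKummer X = PolyIso.full _ _)
    {X Y : S.HT} (ξ : X ≅ Y) (e : B.realifiedHT.obj X ≅ B.realified.obj (B.dvDelta.obj (S.htToD.obj X)))
    (_he : e ∈ B.realifiedKummer X) :
    (B.realifiedHT.mapIso ξ).symm ≪≫ e ≪≫ B.realified.mapIso (B.dvDelta.mapIso (S.htToD.mapIso ξ)) ∈
      B.realifiedKummer Y := by
  rw [hfull Y]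
  exact PolyIso.mem_full _

end BiCoricData

/-- **IUTchIII:Thm1.5(v)** (kurims p.51) at this seat's witness bi-coric datum `Witness.twoBiCoric` (every orbit full) the law holds.
[claim: Mochizuki2012, status: disputed] -/
theorem Witness.twoBiCoric_realifiedKummer_map {X Y : twoFrame.HT} (ξ : X ≅ Y)
    (e : twoBiCoric.realifiedHT.obj X ≅ twoBiCoric.realified.obj (twoBiCoric.dvDelta.obj (twoFrame.htToD.obj X)))
    (he : e ∈ twoBiCoric.realifiedKummer X) :
    (twoBiCoric.realifiedHT.mapIso ξ).symm ≪≫ e ≪≫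
        twoBiCoric.realified.mapIso (twoBiCoric.dvDelta.mapIso (twoFrame.htToD.mapIso ξ)) ∈
      twoBiCoric.realifiedKummer Y :=
  twoBiCoric.realifiedKummer_map_of_full (fun _ => rfl) ξ e he

/-- **IUTchIII:Thm1.5(v)** (kurims p.51) … and at the rigid variant `Witness.twoBiCoricRigid`. [claim: Mochizuki2012, status: disputed] -/
theorem Witness.twoBiCoricRigid_realifiedKummer_map {X Y : twoFrame.HT} (ξ : X ≅ Y)
    (e : twoBiCoricRigid.realifiedHT.obj X ≅
      twoBiCoricRigid.realified.obj (twoBiCoricRigid.dvDelta.obj (twoFrame.htToD.obj X)))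
    (he : e ∈ twoBiCoricRigid.realifiedKummer X) :
    (twoBiCoricRigid.realifiedHT.mapIso ξ).symm ≪≫ e ≪≫
        twoBiCoricRigid.realified.mapIso (twoBiCoricRigid.dvDelta.mapIso (twoFrame.htToD.mapIso ξ)) ∈
      twoBiCoricRigid.realifiedKummer Y :=
  twoBiCoricRigid.realifiedKummer_map_of_full (fun _ => rfl) ξ e he

/-! ### 2. What the law gives: exact transport of the orbit; functoriality of `realifiedTransport` (Thm 1.5 (v), Cor 2.3 (iv)) -/

namespace BiCoricData

variable {S : StripFrame.{u}} (B : BiCoricData S)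

/-- **IUTchIII:Thm1.5(v)** (kurims p.51) under the law (explicit hypothesis), transport along `ξ : X ≅ Y` identifies the orbit at `X` with the
orbit at `Y` EXACTLY: `e` lies in the orbit at `X` iff its conjugate lies in the orbit at `Y` (the law at `ξ` and at `ξ⁻¹`).
[claim: Mochizuki2012, status: disputed] -/
theorem mem_realifiedKummer_iff_conj
    (hlaw : ∀ {X Y : S.HT} (ξ : X ≅ Y) (e : B.realifiedHT.obj X ≅ B.realified.obj (B.dvDelta.obj (S.htToD.obj X))),
      e ∈ B.realifiedKummer X →
        (B.realifiedHT.mapIso ξ).symm ≪≫ e ≪≫ B.realified.mapIso (B.dvDelta.mapIso (S.htToD.mapIso ξ)) ∈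
          B.realifiedKummer Y)
    {X Y : S.HT} (ξ : X ≅ Y) (e : B.realifiedHT.obj X ≅ B.realified.obj (B.dvDelta.obj (S.htToD.obj X))) :
    e ∈ B.realifiedKummer X ↔
      (B.realifiedHT.mapIso ξ).symm ≪≫ e ≪≫ B.realified.mapIso (B.dvDelta.mapIso (S.htToD.mapIso ξ)) ∈
        B.realifiedKummer Y := by
  refine ⟨hlaw ξ e, fun h => ?_⟩
  have h' := hlaw ξ.symm _ h
  simp only [Functor.mapIso_symm, Iso.symm_symm_eq, Iso.trans_assoc, Iso.self_symm_id_assoc, Iso.self_symm_id,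
    Iso.trans_refl] at h'
  exact h'

/-- **IUTchIII:Cor2.3(iv)** (kurims p.75) ← **Thm 1.5 (v)** p.51 — THE CONSEQUENCE GAP row G-w4d026-1 names: under the law (explicit
hypothesis), the transported poly-isomorphism of Frobenius-like realified data `(^XC^⊩_△, …) ⥲ (^YC^⊩_△, …)`
(`realifiedTransport`: `ℝ_{>0}`-orbit at `X`, bi-coric realified poly-isomorphism, inverse orbit at `Y`) is FUNCTORIAL in
arbitrary isomorphisms of Hodge theaters at both ends: conjugating by `α : X ≅ X'`, `β : Y ≅ Y'` (through
`†HT ↦ (^†C^⊩_△, …)`) gives the transported poly-isomorphism from `X'` to `Y'`. [claim: Mochizuki2012, status: disputed] -/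
theorem realifiedTransport_conj
    (hlaw : ∀ {X Y : S.HT} (ξ : X ≅ Y) (e : B.realifiedHT.obj X ≅ B.realified.obj (B.dvDelta.obj (S.htToD.obj X))),
      e ∈ B.realifiedKummer X →
        (B.realifiedHT.mapIso ξ).symm ≪≫ e ≪≫ B.realified.mapIso (B.dvDelta.mapIso (S.htToD.mapIso ξ)) ∈
          B.realifiedKummer Y)
    {X X' Y Y' : S.HT} (α : X ≅ X') (β : Y ≅ Y') :
    ((PolyIso.single (B.realifiedHT.mapIso α).symm).comp (B.realifiedTransport X Y)).comp
        (PolyIso.single (B.realifiedHT.mapIso β)) =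
      B.realifiedTransport X' Y' := by
  ext g
  constructor
  · rintro ⟨g₁, ⟨a, ha, t, ⟨u, ⟨e, he, m, ⟨d, -, rfl⟩, rfl⟩, c, ⟨f, hf, rfl⟩, rfl⟩, rfl⟩, b, hb, rfl⟩
    rw [PolyIso.mem_single] at ha hb
    subst ha hb
    refine ⟨_, ⟨_, hlaw α e he, B.realified.mapIso
        ((B.dvDelta.mapIso (S.htToD.mapIso α)).symm ≪≫ d ≪≫ B.dvDelta.mapIso (S.htToD.mapIso β)),
      ⟨_, PolyIso.mem_full _, rfl⟩, rfl⟩, _, ⟨_, hlaw β f hf, rfl⟩, ?_⟩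
    simp only [Functor.mapIso_trans, Functor.mapIso_symm, Iso.trans_symm, Iso.symm_symm_eq, Iso.trans_assoc,
      Iso.self_symm_id_assoc]
  · rintro ⟨u, ⟨e', he', m, ⟨d', -, rfl⟩, rfl⟩, c, ⟨f', hf', rfl⟩, rfl⟩
    have he := hlaw α.symm e' he'
    have hf := hlaw β.symm f' hf'
    refine ⟨_, ⟨(B.realifiedHT.mapIso α).symm, PolyIso.mem_single.mpr rfl, _, ⟨_, ⟨_, he, B.realified.mapIso
        ((B.dvDelta.mapIso (S.htToD.mapIso α.symm)).symm ≪≫ d' ≪≫ B.dvDelta.mapIso (S.htToD.mapIso β.symm)),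
      ⟨_, PolyIso.mem_full _, rfl⟩, rfl⟩, _, ⟨_, hf, rfl⟩, rfl⟩, rfl⟩, B.realifiedHT.mapIso β,
      PolyIso.mem_single.mpr rfl, ?_⟩
    simp only [Functor.mapIso_trans, Functor.mapIso_symm, Iso.trans_symm, Iso.symm_symm_eq, Iso.trans_assoc,
      Iso.symm_self_id_assoc, Iso.symm_self_id, Iso.trans_refl]

/-- **IUTchIII:Cor2.3(iv)** (kurims p.75) in particular (`X' = X`, `Y' = Y`): under the law, `realifiedTransport X Y` is STABILIZED by the
automorphisms induced by arbitrary automorphisms of `^XHT` and `^YHT` — the `ℝ_{>0}`-orbit half of the Cor 2.3 (iv) clause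
"stabilized/equivariant/functorial with respect to arbitrary automorphisms", which `EtalePictureThetaProofs.lean` records as a
SLOT (`cor23iv_realified_stabilized` covers the `D^⊢`-side only). [claim: Mochizuki2012, status: disputed] -/
theorem realifiedTransport_stabilized
    (hlaw : ∀ {X Y : S.HT} (ξ : X ≅ Y) (e : B.realifiedHT.obj X ≅ B.realified.obj (B.dvDelta.obj (S.htToD.obj X))),
      e ∈ B.realifiedKummer X →
        (B.realifiedHT.mapIso ξ).symm ≪≫ e ≪≫ B.realified.mapIso (B.dvDelta.mapIso (S.htToD.mapIso ξ)) ∈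
          B.realifiedKummer Y)
    {X Y : S.HT} (α : X ≅ X) (β : Y ≅ Y) :
    ((PolyIso.single (B.realifiedHT.mapIso α).symm).comp (B.realifiedTransport X Y)).comp
        (PolyIso.single (B.realifiedHT.mapIso β)) =
      B.realifiedTransport X Y :=
  B.realifiedTransport_conj hlaw α β

end BiCoricData

/-! ### 3. The real frame: the law for `BiCoricData.ofKits` IS the kit-level law; the toy decision -/

section Kit

variable {l : ℕ} {K : PMBaseKit.{u} l} {M : K.MultKit} {FK : K.FKit M}
  (L : FK.MonoLaws) (hbij : FK.IsomFtoDBijective) (hsurj : FK.IsomFmtoDmSurjective) (hR : FK.RlfOfIsStrip)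
  (X : TimesMuSide FK L) (Bk : BiCoricKit X)

/-- **IUTchIII:Thm1.5(v)** (kurims p.51) **G-w4d026-1 AT THE REAL FRAME.** For `BiCoricData.ofKits … Bk` over `StripFrame.ofKits L hbij hsurj hR X`
the functoriality law of the `ℝ_{>0}`-orbit holds IF AND ONLY IF the kit-level orbit `Bk.realifiedKummer` satisfies the same law
on the representative-level Hodge theaters `HTRep FK` (transport along `ξ : H ≅ H'` through `Bk.realifiedHT`,
`Bk.realified ∘ Bk.dvDelta ∘ (†ℋ𝒯 ↦ †ℋ𝒯^𝒟)`): the wanted field is exactly this one law on the kit-level input of [IUTchII] Cor 4.6 (ii)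
(owner abc-iut-L6-t2), nothing on the [IUTchIII] side. [claim: Mochizuki2012, status: disputed] -/
theorem BiCoricData.ofKits_realifiedKummer_map_iff :
    (∀ {A A' : (StripFrame.ofKits L hbij hsurj hR X).HT} (ξ : A ≅ A')
        (e : (BiCoricData.ofKits L hbij hsurj hR X Bk).realifiedHT.obj A ≅
          (BiCoricData.ofKits L hbij hsurj hR X Bk).realified.obj
            ((BiCoricData.ofKits L hbij hsurj hR X Bk).dvDelta.obj ((StripFrame.ofKits L hbij hsurj hR X).htToD.obj A))),
        e ∈ (BiCoricData.ofKits L hbij hsurj hR X Bk).realifiedKummer A →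
          ((BiCoricData.ofKits L hbij hsurj hR X Bk).realifiedHT.mapIso ξ).symm ≪≫ e ≪≫
              (BiCoricData.ofKits L hbij hsurj hR X Bk).realified.mapIso
                ((BiCoricData.ofKits L hbij hsurj hR X Bk).dvDelta.mapIso
                  ((StripFrame.ofKits L hbij hsurj hR X).htToD.mapIso ξ)) ∈
            (BiCoricData.ofKits L hbij hsurj hR X Bk).realifiedKummer A') ↔
      ∀ {H H' : HTRep FK} (ξ : H ≅ H')
        (e : Bk.realifiedHT.obj H ≅ Bk.realified.obj (Bk.dvDelta.obj (HTRep.toDFunctor.obj H))),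
        e ∈ Bk.realifiedKummer H →
          (Bk.realifiedHT.mapIso ξ).symm ≪≫ e ≪≫ Bk.realified.mapIso (Bk.dvDelta.mapIso (HTRep.toDFunctor.mapIso ξ)) ∈
            Bk.realifiedKummer H' := by
  constructor
  · intro hf H H' ξ e he
    have h := hf (AsSmall.up.mapIso ξ) (AsSmall.up.mapIso e) ⟨e, he, rfl⟩
    rw [BiCoricData.ofKits_mem_realifiedKummer_iff] at h
    exact h
  · rintro hk A A' ξ e ⟨e₀, he₀, rfl⟩
    exact ⟨_, hk (AsSmall.down.mapIso ξ) e₀ he₀, Iso.ext rfl⟩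

end Kit

namespace KitsToy

variable (l : ℕ) [Fact l.Prime] (hl : l ≠ 2)

/-- **IUTchIII:Thm1.5(v)** (kurims p.51) DECISION AT THE LANDED INSTANCE: for the bi-coric datum of the toy glue `KitsToy.latticeGlue` (assembled by
`BiCoricData.ofKits` from abc-iut-w4-d005's toy kit `KitsToy.biCoricKit`, whose `ℝ_{>0}`-orbit datum is the FULL poly-isomorphism
into the genuinely-shaped `RlfImage`) the functoriality law of GAP row G-w4d026-1 HOLDS — by §3 it is the kit-level law,
and a full orbit is transport-stable. Toy-class consistency witness; nothing about real Hodge theaters.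
[claim: Mochizuki2012, status: disputed] -/
theorem latticeGlue_realifiedKummer_map {A A' : (frame l hl).HT} (ξ : A ≅ A')
    (e : (latticeGlue l hl).biCoric.realifiedHT.obj A ≅
      (latticeGlue l hl).biCoric.realified.obj
        ((latticeGlue l hl).biCoric.dvDelta.obj ((frame l hl).htToD.obj A)))
    (he : e ∈ (latticeGlue l hl).biCoric.realifiedKummer A) :
    ((latticeGlue l hl).biCoric.realifiedHT.mapIso ξ).symm ≪≫ e ≪≫
        (latticeGlue l hl).biCoric.realified.mapIso
          ((latticeGlue l hl).biCoric.dvDelta.mapIso ((frame l hl).htToD.mapIso ξ)) ∈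
      (latticeGlue l hl).biCoric.realifiedKummer A' :=
  (BiCoricData.ofKits_realifiedKummer_map_iff (FKit.MonoLaws.toy l hl) (FKit.isomFtoDBijective_toy l hl)
      (FKit.isomFmtoDmSurjective_toy l hl) (FKit.rlfOfIsStrip_toy l hl) (timesMuSide l hl) (biCoricKit l hl)).mpr
    (fun _ _ _ => PolyIso.mem_full _) ξ e he

end KitsToy

end Literature.IUT.LogThetaLattice
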